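import Mathlib
import HarnessLib
import Summits.AtomisticToContinuum.HydrodynamicLimit.Theses.AthermalClockWard

/-!
# Birth skeleton (BC3) for crux `EnergyFluxResponse` — route AthermalClockWard, item stmt-AtomisticToContinuum-17509

Line `birth` = the route's own WARD READING of the crux, typed. The crux asks that the one athermal
covariance of the time-`s` empirical ENERGY field with the initial energy score,
`C_N(s) := Cov_{LG_N}(K_N, ⟨e_N(Φ_s z), χ⟩)`, converge to `s·∂_s e(s) + 2 e(s)`, `e(s) := ∫ χ E_s`,
UNIFORMLY in `s ∈ [0, t]` (dilute band, local Gibbs data, classical hs-Euler solution on `[0,T)`, `t < T`).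
By the finite-`N` Ward identity (energy clause of the route support `WardIdentity`),
`d/ds [s² V_N(s)] = s · C_N(s)` for `s > 0`, `V_N(s) := E_{LG_N}⟨e_N(Φ_s z), χ⟩` the MEAN energy field; so for
`s > 0`, `C_N(s) = s V_N'(s) + 2 V_N(s)` and the crux splits along the two orders of the dilation
generator `s∂_s + 2` into a FIELD half and a CURRENT half, plus the static direction at `s = 0` where the
identity is silent:

* `stub_wardEnergy` (W) — the energy clause of `WardIdentity` verbatim (finite `N`, exact; provable now:
  it is `(WardIdentity …).2.2` once the route support stmt-AtomisticToContinuum-11931 lands; from scratch: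
  `ScalingCovariance` = `IsHardSphereTrajectory.timeDilate` + Gaussian change of variables, differentiated in
  the dilation parameter `c` at `1` under `∫`, score `K`, mean `0`). Size M–L.
* `stub_staticEnergyDirection` (S) — `s = 0`: `C_N(0) → 2 e(0)`. Given the positions the velocities are
  independent Gaussians (`lintegral_localGibbsMeasure`), `E[κ_i | x] = 0` and
  `Cov(κ_i, |v_i|²/2 | x_i) = |u₀(x_i)|² + 3θ₀(x_i)`, so `C_N(0) = E⟨n_N, χ(|u₀|² + 3θ₀)⟩` exactly
  (`Φ_0 = id` a.e., `localGibbsLaw ≪` Liouville); the `t = 0` law of large numbers (all three clauses, continuous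
  weights allowed by `TendstoHydroFieldsAt`) identifies the limit with `∫χρ₀(|u₀|² + 3θ₀) = 2∫χE₀`. Provable now, size M.
* `stub_meanEnergyField` (F) — the MEAN ENERGY FIELD follows Euler uniformly in time: `V_N → e` uniformly on
  `[0,t]` (zeroth order of the generator). Open (the energy component of the mean hydrodynamic limit, uniform on
  compacts before the shock); implied by the crux + W (integrate `d/ds(s²V_N) = sC_N`: `|V_N − e| ≤ ε/2` on `(0,t]`),
  so no strength is added.
* `stub_meanEnergyCurrentClosure` (J) — the MEAN ENERGY CURRENT closes on `(E + p)u`, in the dilation weight: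
  at finite `N` the mean energy field is differentiable at every `s ∈ (0,t]` (its derivative `w_N(s)` IS the mean
  microscopic energy current — kinetic cubic moment + collisional transfer — tested on `∇χ`, by the energy balance),
  and `s·w_N(s) → s·∂_s e(s)` uniformly on `[0,t]`, `∂_s e = derivWithin e [0,T) = −∫χ div((E+p)u)` by
  `IsHardSphereEulerSolution.energy` (first order of the generator). Open, LOAD-BEARING (Spohn1991 §3.2 (3.8), (3.14),
  (3.17): zero Euler-order heat current in mean + collisional energy transfer → `p u`; the cubic velocity moment along
  the deterministic flow is where `Literature.Barriers.AtomisticToContinuum.HighMomentumCutoffBarrier` bites; the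
  weight `s` is intrinsic — the Ward covariance only sees `s·V_N'` — and absorbs the kinetic initial layer).

Composition `EnergyFluxResponse_of (hW) (hS) (hF) (hJ) : EnergyFluxResponse` (hypotheses = the four stub statements
BY NAME, `def stub_* : Prop := type_of% Holds.stub_*`; kernel-checked, no placeholders): thresholds `η := min η_F η_J`,
`σ₀ := min σ_S (min σ_F σ_J)`; then the abstract calculus lemma `tendstoUniformlyOn_of_ward` — on `(0,t]` the product
rule and uniqueness of derivatives (`HasDerivAt.unique`) turn W + J(i) into the pointwise identity
`C_N(s) = s·w_N(s) + 2·V_N(s)`, and the ε/2 + 2·ε/4 estimate from J(ii) + F closes; at `s = 0`, S. Given W and S the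
crux is EQUIVALENT to F ∧ J (converse by one integration), so the split is faithful: F = field, J = current.
Neither stub is the crux (W, S are finite-`N`/static; F has no covariance and no derivative; J has no covariance and
no zeroth-order term) nor the summit (no convergence in probability of three fields anywhere): BC3 probes
`stub → EnergyFluxResponse`, `stub → HydrodynamicLimit` by `first | exact? | simpa | aesop` fail for all four
(planner folder `bc/probe_*.lean`). Disproof used: none on file (`ledger crux ls stmt-AtomisticToContinuum-17509`: no
workfiles at registration). Negatives index (`ledger negatives --problem AtomisticToContinuum`, 20 entries, 2026-08-17):
none concerns a Ward identity, a mean-field or a mean-current limit; the nearest, EulerCharacteristics.ExpTailBudget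
(stmt-14607, refuted-misstated: an `exp(−cN)` budget for the CUBIC tail at `t = 0`), has no counterpart — no stub here
asks a tail or large-deviation bound (J is an expectation-level closure with the dilation weight).
Foreseen layer-2 (not filed): J ⇐ (J_kin) cubic conditional velocity moment locally Maxwellian in mean (heat current
`q = 0`) + (J_coll) mean collisional energy transfer → `p_ex u` (contact virial for the energy current) + the finite-`N`
energy balance identifying `w_N`; F ⇐ J + S-type statics + a short-time uniform bound on the mean energy current
(docks to the cruxes `CubicMomentUI` (stmt-9454) / `EnergyCurrentTails` of the sibling routes).
Sources: Spohn1991 Part I §3.2 (3.8), (3.14), (3.17), §7.1 (7.16); DuftyBaskaranBrey2008 §7; LebowitzPercusVerlet1967;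
OllaVaradhanYau1993 §1; BodineauGallagherSaintRaymondSimonella2023.
-/

noncomputable section

namespace Summit.AtomisticToContinuum.HydrodynamicLimit.Cruxes.EnergyFluxResponse.Birth

open scoped BigOperators Topology InnerProductSpace
open Filter Set MeasureTheory

/-! ## The registered stubs (D-0027 §3.3 shape: sorried theorems in `Holds`, statements by name, `_of`) -/

namespace Holds

/-- **Stub W — WARD IDENTITY, ENERGY CLAUSE, at finite `N`** (verbatim the third conjunct of the route support
`AthermalClockWard.WardIdentity`, stmt-AtomisticToContinuum-11931): for `σ > 0`, `t > 0`, continuous positive profiles,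
`N`, `Φ` and continuous `χ`, with `P = localGibbsLaw σ a₀ u₀ θ₀ N Φ` and the initial energy score
`K(z) = Σ_i[(|v_i|² − ⟪v_i,u₀(x_i)⟫)/θ₀(x_i) − 3]`, the map `s ↦ s²·E_P⟨e_N(Φ_s z),χ⟩` has derivative
`t·Cov_P(K, ⟨e_N(Φ_t ·),χ⟩)` at `t`. Why true: `E_{LG(a,cu,c²θ)}F(e_N(t)) = E_{LG}[c² F(e_N(ct))]` (athermality:
`scaleVel c` conjugates `Φ_t` to `Φ_{ct}`, `IsHardSphereTrajectory.timeDilate`, and pushes the local Gibbs law to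
the dilated profiles), an exponential family in `c`; differentiate at `c = 1` under `∫` (Gaussian tails × the
energy-bounded field, energy conserved on the good set). Size M–L, provable now. -/
theorem stub_wardEnergy :
    ∀ (σ t : ℝ), 0 < σ → 0 < t → ∀ (a₀ θ₀ : Literature.MathematicalPhysics.KineticTheory.T3 → ℝ) (u₀ : Literature.MathematicalPhysics.KineticTheory.T3 → Literature.MathematicalPhysics.KineticTheory.V3), Continuous a₀ → Continuous θ₀ → Continuous u₀ → (∀ x, 0 < a₀ x) → (∀ x, 0 < θ₀ x) → ∀ (N : ℕ) (Φ : Literature.Analysis.FluidPDE.HardSphereFlow (Literature.Analysis.FluidPDE.Torus.geometry (Fin 3)) (Literature.MathematicalPhysics.KineticTheory.hsDiameter σ N) (N + 1)) (χ : Literature.MathematicalPhysics.KineticTheory.T3 → ℝ), Continuous χ → HasDerivAt (fun s : ℝ => s ^ 2 * ∫ z, Literature.MathematicalPhysics.KineticTheory.empiricalEnergyField (Φ.flow s z) χ ∂(Literature.MathematicalPhysics.KineticTheory.localGibbsLaw σ a₀ u₀ θ₀ N Φ)) (t * ProbabilityTheory.covariance (fun z : Literature.Analysis.FluidPDE.Config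 (N + 1) (Fin 3) Literature.MathematicalPhysics.KineticTheory.T3 => ∑ i, ((‖(z i).2‖ ^ 2 - ⟪(z i).2, u₀ (z i).1⟫_ℝ) / θ₀ (z i).1 - 3)) (fun z => Literature.MathematicalPhysics.KineticTheory.empiricalEnergyField (Φ.flow t z) χ) (Literature.MathematicalPhysics.KineticTheory.localGibbsLaw σ a₀ u₀ θ₀ N Φ)) t := by
  sorry

/-- **Stub S — STATIC ENERGY DIRECTION (`s = 0`)**: for continuous positive profiles there is `σ₀ > 0` (`= 1/2`,
`isProbabilityMeasure_localGibbsLaw`) such that for `0 < σ < σ₀`, all macroscopic fields `(ρ, u, θ)`, every flow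
family `Φ` with the `t = 0` law of large numbers under the local Gibbs laws, and every continuous `χ`:
`Cov_{P_N}(K_N, ⟨e_N(Φ_0 z),χ⟩) → 2∫χE₀`. Why true: `Φ_0 = id` `P_N`-a.e.; given the positions the velocities are
independent `N(u₀(x_i), θ₀(x_i)I₃)` (`lintegral_localGibbsMeasure`), `E[κ_i | x] = 0`, cross terms vanish and
`Cov(κ_i, |v_i|²/2 | x_i) = |u₀(x_i)|² + 3θ₀(x_i)`, so the covariance EQUALS `E⟨n_N, χ(|u₀|² + 3θ₀)⟩` at each `N`;
the density clause of the LLN (continuous weight, bounded statistic, probability measures ⇒ convergence of means)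
gives `∫χρ₀(|u₀|² + 3θ₀)`, and the momentum/energy clauses at `t = 0` (Chebyshev on the conditional Gaussian
fluctuations) identify it with `2∫χE₀ = ∫χρ₀(|u(0)|² + 3θ(0))`. Size M, provable now. -/
theorem stub_staticEnergyDirection :
    ∀ (a₀ θ₀ : Literature.MathematicalPhysics.KineticTheory.T3 → ℝ) (u₀ : Literature.MathematicalPhysics.KineticTheory.T3 → Literature.MathematicalPhysics.KineticTheory.V3), Continuous a₀ → Continuous θ₀ → Continuous u₀ → (∀ x, 0 < a₀ x) → (∀ x, 0 < θ₀ x) → ∃ σ₀ : ℝ, 0 < σ₀ ∧ ∀ σ : ℝ, 0 < σ → σ < σ₀ → ∀ (ρ θ : ℝ → Literature.MathematicalPhysics.KineticTheory.T3 → ℝ) (u : ℝ → Literature.MathematicalPhysics.KineticTheory.T3 → Literature.MathematicalPhysics.KineticTheory.V3) (Φ : (N : ℕ) → Literature.Analysis.FluidPDE.HardSphereFlow (Literature.Analysis.FluidPDE.Torus.geometry (Fin 3)) (Literature.MathematicalPhysics.KineticTheory.hsDiameter σ N) (N + 1)), Literature.MathematicalPhysics.KineticTheory.TendstoHydroFieldsAt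 (fun N => Literature.MathematicalPhysics.KineticTheory.localGibbsLaw σ a₀ u₀ θ₀ N (Φ N)) Φ ρ u θ 0 → ∀ χ : Literature.MathematicalPhysics.KineticTheory.T3 → ℝ, Continuous χ → Filter.Tendsto (fun N : ℕ => ProbabilityTheory.covariance (fun z : Literature.Analysis.FluidPDE.Config (N + 1) (Fin 3) Literature.MathematicalPhysics.KineticTheory.T3 => ∑ i, ((‖(z i).2‖ ^ 2 - ⟪(z i).2, u₀ (z i).1⟫_ℝ) / θ₀ (z i).1 - 3)) (fun z => Literature.MathematicalPhysics.KineticTheory.empiricalEnergyField ((Φ N).flow 0 z) χ) (Literature.MathematicalPhysics.KineticTheory.localGibbsLaw σ a₀ u₀ θ₀ N (Φ N))) Filter.atTop (nhds (2 * ∫ x, χ x * Literature.MathematicalPhysics.KineticTheory.totalEnergyDensity (ρ 0 x) (u 0 x) (θ 0 x))) := by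
  sorry

/-- **Stub F — MEAN ENERGY FIELD FOLLOWS EULER, UNIFORMLY IN TIME** (zeroth order of the dilation generator): with
the crux's prefix (packing threshold `η`, continuous positive profiles, `0 < σ < σ₀`, a classical hard-sphere Euler
solution on `[0,T)` with packing `ρ_t(x)σ³ < η`, a flow family with the `t = 0` LLN, `t < T`, smooth `χ`):
`E_{LG_N}⟨e_N(Φ_s z),χ⟩ → ∫χE_s` uniformly in `s ∈ [0,t]`. Why plausibly true: it is the energy component of the
mean hydrodynamic limit, uniform on a compact pre-shock interval; it FOLLOWS from the crux and W by one integration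
(`s²V_N(s) = ∫₀ˢ r C_N(r) dr`), so it adds no strength to the line; at `s = 0` it is the LLN in mean. Open (size =
the mean energy-field limit); obstruction shared with the crux (local equilibrium in mean at fixed small `σ`). -/
theorem stub_meanEnergyField :
    ∃ η : ℝ, 0 < η ∧ ∀ (a₀ θ₀ : Literature.MathematicalPhysics.KineticTheory.T3 → ℝ) (u₀ : Literature.MathematicalPhysics.KineticTheory.T3 → Literature.MathematicalPhysics.KineticTheory.V3), Continuous a₀ → Continuous θ₀ → Continuous u₀ → (∀ x, 0 < a₀ x) → (∀ x, 0 < θ₀ x) → ∃ σ₀ : ℝ, 0 < σ₀ ∧ ∀ σ : ℝ, 0 < σ → σ < σ₀ → ∀ (T : ℝ) (ρ θ : ℝ → Literature.MathematicalPhysics.KineticTheory.T3 → ℝ) (u : ℝ → Literature.MathematicalPhysics.KineticTheory.T3 → Literature.MathematicalPhysics.KineticTheory.V3), Literature.MathematicalPhysics.KineticTheory.IsHardSphereEulerSolution σ T ρ u θ → (∀ t ∈ Set.Ico 0 T, ∀ x, ρ t x * σ ^ 3 < η) → ∀ Φ : (N : ℕ) → Literature.Analysis.FluidPDE.HardSphereFlow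 (Literature.Analysis.FluidPDE.Torus.geometry (Fin 3)) (Literature.MathematicalPhysics.KineticTheory.hsDiameter σ N) (N + 1), Literature.MathematicalPhysics.KineticTheory.TendstoHydroFieldsAt (fun N => Literature.MathematicalPhysics.KineticTheory.localGibbsLaw σ a₀ u₀ θ₀ N (Φ N)) Φ ρ u θ 0 → ∀ t ∈ Set.Ico 0 T, ∀ χ : Literature.MathematicalPhysics.KineticTheory.T3 → ℝ, Literature.Analysis.FunctionSpaces.Torus.IsSmooth χ → TendstoUniformlyOn (fun (N : ℕ) (s : ℝ) => ∫ z, Literature.MathematicalPhysics.KineticTheory.empiricalEnergyField ((Φ N).flow s z) χ ∂(Literature.MathematicalPhysics.KineticTheory.localGibbsLaw σ a₀ u₀ θ₀ N (Φ N))) (fun s => ∫ x, χ x * Literature.MathematicalPhysics.KineticTheory.totalEnergyDensity (ρ s x) (u s x) (θ s x)) Filter.atTop (Set.Icc 0 t) := by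
  sorry

/-- **Stub J — MEAN ENERGY-CURRENT CLOSURE in the dilation weight** (first order of the generator; LOAD-BEARING): with
the crux's prefix, (i) at every finite `N` the mean energy field `s ↦ E_{LG_N}⟨e_N(Φ_s z),χ⟩` is differentiable at each
`s ∈ (0,t]` with derivative `w_N(s)` — by the microscopic energy balance `w_N(s)` IS the mean energy CURRENT (kinetic
`(N+1)⁻¹Σ_i ∇χ(x_i)·v_i|v_i|²/2` plus the collisional energy transfer at contact) — and (ii)
`s·w_N(s) → s·∂_s∫χE_s` uniformly on `[0,t]`, where `∂_s∫χE_s = derivWithin (∫χE) [0,T) s = ∫∇χ·(E_s + p_s)u_s` by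
`IsHardSphereEulerSolution.energy`: the mean energy current closes on the Euler enthalpy flux — zero Euler-order HEAT
CURRENT in mean (cubic conditional velocity moment locally Maxwellian) and collisional transfer → `p_ex u` (Spohn1991
§3.2 (3.8), (3.14), (3.17)). The weight `s` is what the Ward covariance sees (`C_N = s·V_N' + 2V_N`) and absorbs the
kinetic initial layer. Why it might fail: exactly the crux's — no `|v|³` uniform integrability along the deterministic
flow at fixed `σ` is known (`HighMomentumCutoffBarrier`); a heat current surviving in mean, or a mean energy flux
oscillating at kinetic frequency, makes (ii) false. Open, size = open-problem; (i) alone follows from W. -/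
theorem stub_meanEnergyCurrentClosure :
    ∃ η : ℝ, 0 < η ∧ ∀ (a₀ θ₀ : Literature.MathematicalPhysics.KineticTheory.T3 → ℝ) (u₀ : Literature.MathematicalPhysics.KineticTheory.T3 → Literature.MathematicalPhysics.KineticTheory.V3), Continuous a₀ → Continuous θ₀ → Continuous u₀ → (∀ x, 0 < a₀ x) → (∀ x, 0 < θ₀ x) → ∃ σ₀ : ℝ, 0 < σ₀ ∧ ∀ σ : ℝ, 0 < σ → σ < σ₀ → ∀ (T : ℝ) (ρ θ : ℝ → Literature.MathematicalPhysics.KineticTheory.T3 → ℝ) (u : ℝ → Literature.MathematicalPhysics.KineticTheory.T3 → Literature.MathematicalPhysics.KineticTheory.V3), Literature.MathematicalPhysics.KineticTheory.IsHardSphereEulerSolution σ T ρ u θ → (∀ t ∈ Set.Ico 0 T, ∀ x, ρ t x * σ ^ 3 < η) → ∀ Φ : (N : ℕ) → Literature.Analysis.FluidPDE.HardSphereFlow (Literature.Analysis.FluidPDE.Torus.geometry (Fin 3)) (Literature.MathematicalPhysics.KineticTheory.hsDiameter σ N) (N + 1), Literature.MathematicalPhysics.KineticTheory.TendstoHydroFieldsAt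 (fun N => Literature.MathematicalPhysics.KineticTheory.localGibbsLaw σ a₀ u₀ θ₀ N (Φ N)) Φ ρ u θ 0 → ∀ t ∈ Set.Ico 0 T, ∀ χ : Literature.MathematicalPhysics.KineticTheory.T3 → ℝ, Literature.Analysis.FunctionSpaces.Torus.IsSmooth χ → ∃ w : ℕ → ℝ → ℝ, (∀ N : ℕ, ∀ s ∈ Set.Ioc 0 t, HasDerivAt (fun r : ℝ => ∫ z, Literature.MathematicalPhysics.KineticTheory.empiricalEnergyField ((Φ N).flow r z) χ ∂(Literature.MathematicalPhysics.KineticTheory.localGibbsLaw σ a₀ u₀ θ₀ N (Φ N))) (w N s) s) ∧ TendstoUniformlyOn (fun (N : ℕ) (s : ℝ) => s * w N s) (fun s => s * derivWithin (fun s' => ∫ x, χ x * Literature.MathematicalPhysics.KineticTheory.totalEnergyDensity (ρ s' x) (u s' x) (θ s' x)) (Set.Ico 0 T) s) Filter.atTop (Set.Icc 0 t) := by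
  sorry

end Holds

/-! ## The stub statements by name (hypotheses of `EnergyFluxResponse_of`) -/

/-- Statement of `Holds.stub_wardEnergy` (registered stub W). -/
def stub_wardEnergy : Prop := type_of% Holds.stub_wardEnergy

/-- Statement of `Holds.stub_staticEnergyDirection` (registered stub S). -/
def stub_staticEnergyDirection : Prop := type_of% Holds.stub_staticEnergyDirection

/-- Statement of `Holds.stub_meanEnergyField` (registered stub F). -/
def stub_meanEnergyField : Prop := type_of% Holds.stub_meanEnergyField

/-- Statement of `Holds.stub_meanEnergyCurrentClosure` (registered stub J, load-bearing). -/
def stub_meanEnergyCurrentClosure : Prop := type_of% Holds.stub_meanEnergyCurrentClosure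

/-! ## Proved glue: the calculus of the dilation generator `s∂_s + 2` -/

/-- **Ward assembly, abstract form** (pure one-variable calculus, kernel-checked). If at every index `N`
`d/ds[s²V_N(s)] = s·C_N(s)` on `(0,t]` (Ward), `V_N` is differentiable there with derivative `w_N` and
`s·w_N → s·e'` uniformly on `[0,t]` (current), `V_N → e` uniformly on `[0,t]` (field), and `C_N(0) → 2e(0)`
(static direction), then `C_N → s·e' + 2e` uniformly on `[0,t]`. On `(0,t]` the product rule and uniqueness of the
derivative give `C_N = s·w_N + 2V_N` pointwise; `s = 0` is the static input. -/
theorem tendstoUniformlyOn_of_ward {t : ℝ} {C V w : ℕ → ℝ → ℝ} {e e' : ℝ → ℝ}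
    (hW : ∀ N : ℕ, ∀ s ∈ Set.Ioc 0 t, HasDerivAt (fun r : ℝ => r ^ 2 * V N r) (s * C N s) s)
    (hS : Tendsto (fun N : ℕ => C N 0) atTop (𝓝 (2 * e 0)))
    (hF : TendstoUniformlyOn V e atTop (Set.Icc 0 t))
    (hJ₁ : ∀ N : ℕ, ∀ s ∈ Set.Ioc 0 t, HasDerivAt (V N) (w N s) s)
    (hJ₂ : TendstoUniformlyOn (fun (N : ℕ) (s : ℝ) => s * w N s) (fun s => s * e' s) atTop (Set.Icc 0 t)) :
    TendstoUniformlyOn C (fun s => s * e' s + 2 * e s) atTop (Set.Icc 0 t) := by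
  -- the pointwise Ward identity on `(0, t]`
  have hC : ∀ N : ℕ, ∀ s ∈ Set.Ioc 0 t, C N s = s * w N s + 2 * V N s := by
    intro N s hs
    have hpow : HasDerivAt (fun r : ℝ => r ^ 2) (2 * s) s := by
      simpa using hasDerivAt_pow 2 s
    have hprod : HasDerivAt (fun r : ℝ => r ^ 2 * V N r) (2 * s * V N s + s ^ 2 * w N s) s :=
      hpow.mul (hJ₁ N s hs)
    have hid : s * C N s = 2 * s * V N s + s ^ 2 * w N s := (hW N s hs).unique hprod
    have hs0 : s ≠ 0 := hs.1.ne'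
    have h' : s * C N s = s * (s * w N s + 2 * V N s) := by rw [hid]; ring
    exact mul_left_cancel₀ hs0 h'
  rw [Metric.tendstoUniformlyOn_iff] at hF hJ₂ ⊢
  intro ε hε
  have hε2 : 0 < ε / 2 := half_pos hε
  have hε4 : 0 < ε / 4 := by positivity
  filter_upwards [Metric.tendsto_nhds.1 hS ε hε, hF (ε / 4) hε4, hJ₂ (ε / 2) hε2] with N hN0 hNF hNJ
  intro s hs
  rcases eq_or_lt_of_le hs.1 with h0 | hpos
  · subst h0
    rw [zero_mul, zero_add, dist_comm]
    exact hN0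
  · rw [hC N s ⟨hpos, hs.2⟩]
    have h2 : dist (2 * e s) (2 * V N s) = 2 * dist (e s) (V N s) := by
      rw [Real.dist_eq, Real.dist_eq, ← mul_sub, abs_mul, abs_two]
    calc dist (s * e' s + 2 * e s) (s * w N s + 2 * V N s)
        ≤ dist (s * e' s) (s * w N s) + dist (2 * e s) (2 * V N s) := dist_add_add_le _ _ _ _
      _ < ε / 2 + 2 * (ε / 4) := by
          rw [h2]
          exact add_lt_add (hNJ s hs) (by linarith [hNF s hs])
      _ = ε := by ring

/-! ## Composition: the four stubs give the crux BY NAME -/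

/-- **`stub_wardEnergy → stub_staticEnergyDirection → stub_meanEnergyField → stub_meanEnergyCurrentClosure →
EnergyFluxResponse`** (hypotheses = the four registered stub statements BY NAME; kernel-checked, axioms ⊆
{propext, Classical.choice, Quot.sound}): `η := min η_F η_J`, `σ₀ := min σ_S (min σ_F σ_J)`; at the data of the
crux, W at `(σ, s, N, Φ N, χ)` for `s ∈ (0,t]` (smooth `χ` is continuous), S at `χ`, F and J at `(t, χ)` feed
`tendstoUniformlyOn_of_ward`. -/
theorem EnergyFluxResponse_of (hW : stub_wardEnergy) (hS : stub_staticEnergyDirection)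
    (hF : stub_meanEnergyField) (hJ : stub_meanEnergyCurrentClosure) :
    Summit.AtomisticToContinuum.HydrodynamicLimit.Theses.AthermalClockWard.EnergyFluxResponse := by
  have hW' : type_of% Holds.stub_wardEnergy := hW
  have hS' : type_of% Holds.stub_staticEnergyDirection := hS
  have hF' : type_of% Holds.stub_meanEnergyField := hF
  have hJ' : type_of% Holds.stub_meanEnergyCurrentClosure := hJ
  clear hW hS hF hJ
  obtain ⟨ηF, hηF, HF⟩ := hF'
  obtain ⟨ηJ, hηJ, HJ⟩ := hJ'
  refine ⟨min ηF ηJ, lt_min hηF hηJ, ?_⟩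
  intro a₀ θ₀ u₀ ha hθ hu ha0 hθ0
  obtain ⟨σS, hσS, GS⟩ := hS' a₀ θ₀ u₀ ha hθ hu ha0 hθ0
  obtain ⟨σF, hσF, GF⟩ := HF a₀ θ₀ u₀ ha hθ hu ha0 hθ0
  obtain ⟨σJ, hσJ, GJ⟩ := HJ a₀ θ₀ u₀ ha hθ hu ha0 hθ0
  refine ⟨min σS (min σF σJ), lt_min hσS (lt_min hσF hσJ), ?_⟩
  intro σ hσ hσlt T ρ θ u hE hpack Φ h0 t ht χ hχ
  have hσS' : σ < σS := hσlt.trans_le (min_le_left _ _)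
  have hσF' : σ < σF := hσlt.trans_le ((min_le_right _ _).trans (min_le_left _ _))
  have hσJ' : σ < σJ := hσlt.trans_le ((min_le_right _ _).trans (min_le_right _ _))
  have hpF : ∀ s ∈ Set.Ico 0 T, ∀ x, ρ s x * σ ^ 3 < ηF :=
    fun s hs x => (hpack s hs x).trans_le (min_le_left _ _)
  have hpJ : ∀ s ∈ Set.Ico 0 T, ∀ x, ρ s x * σ ^ 3 < ηJ :=
    fun s hs x => (hpack s hs x).trans_le (min_le_right _ _)
  have hS0 := GS σ hσ hσS' ρ θ u Φ h0 χ hχ.continuous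
  have hFu := GF σ hσ hσF' T ρ θ u hE hpF Φ h0 t ht χ hχ
  obtain ⟨w, hw, hJu⟩ := GJ σ hσ hσJ' T ρ θ u hE hpJ Φ h0 t ht χ hχ
  refine tendstoUniformlyOn_of_ward ?_ ?_ hFu hw hJu
  · intro N s hs
    exact hW' σ s hσ hs.1 a₀ θ₀ u₀ ha hθ hu ha0 hθ0 N (Φ N) χ hχ.continuous
  · exact hS0

end Summit.AtomisticToContinuum.HydrodynamicLimit.Cruxes.EnergyFluxResponse.Birth

end
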